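import Literature.MathematicalPhysics.QuantumFieldTheory.Balaban1983to89.Beta.RemainderOriginTowerPlaquetteLocalSup
import Literature.MathematicalPhysics.QuantumFieldTheory.Balaban1983to89.Beta.RemainderOriginTowerSliceGradPlaquetteAnyDisplay

/-!
# T. Bałaban, *Propagators for lattice gauge theories in a background field*, Commun. Math. Phys. **99** (1985) 389–434 [Balaban1985BackgroundPropagators]
# (3.137) p. 423 *«hence |(Δ⁽²⁾A)(b)| ≦ O(1)Mα₀(Lʲη)⁻²|A|, b ∈ Δ(y), y ∈ Λ_j, (3.137) and the supremum |A| is taken over several j-blocks surrounding Δ(y)»*,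
# read against [Balaban1985Variational] (182) p. 307, (190) p. 308: **NODE D OF ROW (D4) AT THE ORIGIN ON PRINT's SMALL-FIELD CLASS — THE SLICE-GRADIENT
# LINE OF (190) WITH `Δ⁽²⁾` IN PRINT's (3.137) LOCAL-SUP DISPLAY** — the END «Y12h» `Beta.RemainderOriginTowerSliceGradPlaquetteAnyDisplay` (left entry
# `D_U∘(·)_μ`, fine bonds → fine bonds, every direction `μ`) with its last displayed analytic letter `hD2` re-typed exactly as in «Y13a»
# `Beta.RemainderOriginTowerPlaquetteLocalSup` («Y13c», this lineage gen 114)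

CITATION HEADER (lean-in-tree rule 2026-08-18).  Audit cell `pub-balaban`, BINDER row (D4) (`RemainderConst` leaves for Bałaban's split), OWNER lineage
`b2b-balaban-beta-an4`, gen 114.  Loci exactly as in «Y13a» (this gen) and «Y12h» (gen 112): [Balaban1985BackgroundPropagators] (B9 = [5]; held
`paper:balaban1985-cmp99-background-propagators`, journal page = PDF page + 388) (3.134)–(3.138) pp. 422–423 ((3.137) re-read first-hand this generation),
Thm 3.1 (3.42) p. 397 (the gradient entry), Thm 3.3 p. 399, Thm 3.11 p. 416, (3.35)–(3.37) p. 396, (3.126) p. 420, (3.132)–(3.133) p. 422;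
[Balaban1985Variational] (B11 = [15]; `paper:balaban1985-cmp102-variational-background`, journal page = PDF page + 276) (129)–(131) pp. 297–298, (180) p. 306,
(182) p. 307, (190) p. 308; [Balaban1985Averaging] (B7 = [4]) Prop. 2 (52)–(54) p. 26, (122) p. 36, (136) p. 39; [Balaban1984PropagatorsII] (B6 = [3])
(2.51)–(2.52) p. 232, (2.54) p. 233, Lemma 2.1 (2.61) p. 234.  Composed BY NAME: «Y12h» `Beta.RemainderOriginTowerSliceGradPlaquetteAnyDisplay.exists_ineq190_sliceGrad_origin_tower_plaquette_anyDisplay`,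
«Y13a» `Beta.RemainderOriginTowerPlaquetteLocalSup.localSup_package`.  Nothing of print is asserted here.

WHY THIS FILE («Y13c»).  «Y13a» re-typed the value END's `Δ⁽²⁾` letter in print's (3.137) words and packaged the bookkeeping as `localSup_package`; «Y13b»
did the divergence line; the slice-gradient line («Y12h») carries the SAME letter block `(K_D, λ, hKD, hDloc, hDrow, hDcol, hD2 : HasMaj)` and the derived
constant `B_E^{G′} = B_E + B_Eλe^{(δ∕d)r_D}B_{G′}c`.  THIS FILE proves **`exists_ineq190_sliceGrad_origin_tower_plaquette_localSup`** — «Y12h» with that block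
REPLACED by `(λ₀ ≥ 0, r_D, hD2 : the (3.137) display on the fine bond carrier)` and `λ := λ₀·e^{σ r_D}·c` (`c = c₀(1,σ)^d`) substituted into `q, θ_P, θ_D,
B_E^{G′}`, for every direction `μ`; conclusion VERBATIM («Y12h»: `G′`, `(Q_kG′Q_k†)⁻¹` two-sided and `∀ δ′, δ′∕8 ≤ ρ → Ineq190 S^{coarse}_m S^{fine}_m
((D_U∘(·)_μ)∘(H₀ + G̃Δ⁽²⁾H₀)) (A₀ᴱ + B_Eᵗθ_Dc) δ′` at the consumer's display ∕ witness).  With «Y13a»∕«Y13b», ALL THREE lines of NODE D at the origin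
(value, divergence, slice gradient) now display `Δ⁽²⁾` in print's words.

HONEST SCOPE.  [folklore] bookkeeping: one application of «Y13a» §3 `localSup_package` and one of «Y12h»; NO estimate of [5], [15] or [4] is proved
here; (3.137) is the HYPOTHESIS `hD2`, not proved for any operator; Bałaban's `Δ⁽²⁾(U)` NOT constructed (NODE-O-class identification NOT done; `Δ⁽²⁾ = 0` at
`U = 1`).  Displayed otherwise exactly as in «Y12h» (print's three windows read GLOBALLY on the torus, the weights `ρ_w`, the Hilbert-structure letters,
the two smallnesses — now in `λ₀`).  Row (D4) class UNCHANGED (instance 0∕1; critical-path width 0 = NODE O; D4 DISCHARGE NO DATE); NOT B12 Thm 2, NOT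
BetaPertH, NOT continuum, NOT Clay.  HONEST DEPENDENCY (cell line): continuum YM on T⁴ ⇐ BetaPertH ∧ nine spine estimates (0/9 proved); BetaPertH ⇐ (D1) ∧
(D4) ∧ CAP+tail; G-an2-4 gates asym, D1 and NE2/3/4.  NEW file; nothing modified; 0 `def`; standard axioms; no `sorry`; `maxHeartbeats 400000` on the one END
(the sixty-binder statement, as «Y12h»).  Net new unproved facts: 0.
-/

noncomputable section

open scoped BigOperators InnerProductSpace ComplexConjugate

namespace Literature.MathematicalPhysics.QuantumFieldTheory.Balaban1983to89.Beta.RemainderOriginTowerSliceGradPlaquetteLocalSup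

open B11SectG B11SupSize190
open B4Sect5Torus (TSite tdist tdist_nonneg)
open B4Sect5Proof (latticeConst)
open B5TorusCover (UT)
open B9Thm34Ext (toB6)
open B9Thm37GlueTorus (torusGeom tdist1 tdist1_comm torusSum_tdist1_le)
open B9SectCLatticeCarrier (Bond bpos btgt unshift)
open B9Eq311L2Pairing (WL2)
open B9Eq319QprimeTorus (blockCoord)
open B9Eq315QTower (towerP UlevOf)
open B9Eq315QTorus (perCfg perCfg_apply cornerSite)
open B9Eq316TowerFlatIsOneStep (siteCast towerP_eq_fineP_pow)
open B7Prop1Explicit (U1 Wcx boxVec)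
open B7Prop2Explicit (c2' unitaryUnits)
open B9Eq310DeltaPrime (plaqHolU)
open B9Eq310HessianOperator (adTransportW)
open B11Eq103H1Complex (SiteL2K BondL2K covDerivL2K covDivL2K)
open B9Eq326OperatorTower (laplaceAk QkW G1k H1k)
open Beta.RemainderOriginTowerPlaquetteLocalSup (localSup_package)
open Beta.RemainderOriginTowerSliceGradPlaquetteAnyDisplay (exists_ineq190_sliceGrad_origin_tower_plaquette_anyDisplay)

/-! ## The slice-gradient line of NODE D at the origin on print's class, `Δ⁽²⁾` in print's (3.137) display -/

section Tower

variable {d : ℕ} (hd : 1 ≤ d) (L : ℕ) [NeZero L] (hL : 1 ≤ L) (hL3 : 3 ≤ L)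
  {𝔸 : Type*} [CStarAlgebra 𝔸] [Nontrivial 𝔸]
  {W : Type} [NormedAddCommGroup W] [InnerProductSpace ℂ W] [FiniteDimensional ℂ W] (φ : W ≃ₗ[ℂ] 𝔸)
  {Mφ Mφ' : ℝ} (hMφ : 0 ≤ Mφ) (hMφ' : 0 ≤ Mφ') (hφ : ∀ w, ‖φ w‖ ≤ Mφ * ‖w‖) (hφ' : ∀ X, ‖φ.symm X‖ ≤ Mφ' * ‖X‖)
  {a : ℝ} (ha : 0 < a) {a' : ℝ} (ha' : 0 < a')
  (τ : 𝔸 →ₗ[ℂ] ℂ) {Cτ : ℝ} (hτ : ∀ X, ‖τ X‖ ≤ Cτ * ‖X‖) (hCτ : 0 ≤ Cτ) {Mτ : ℝ} (hτm : ∀ X Y : 𝔸, ‖τ (X * Y)‖ ≤ Mτ * ‖X‖ * ‖Y‖) (hMτ : 0 ≤ Mτ)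
  {ρw : ℝ} (hρw : 0 ≤ ρw)
  (hτ₁ : ∀ X : 𝔸, τ (star X) = conj (τ X)) (hτ₂ : ∀ X Y : 𝔸, τ (X * Y) = τ (Y * X)) (hφτ : ∀ X Y : 𝔸, ⟪φ.symm X, φ.symm Y⟫_ℂ = τ (star X * Y))
  (AQ : ℝ) (hAQ16 : 16 * ((d : ℝ) + 1) * ((d : ℝ) + 4) * c2' d L ≤ AQ)

set_option maxHeartbeats 400000 in
include hd hL hL3 hMφ hMφ' hφ hφ' ha ha' hτ hCτ hτm hMτ hρw hτ₁ hτ₂ hφτ hAQ16 in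
/-- **THE SLICE-GRADIENT LINE OF NODE D AT THE ORIGIN ON PRINT's CLASS, `Δ⁽²⁾` IN PRINT's (3.137) DISPLAY** («Y12h»
`exists_ineq190_sliceGrad_origin_tower_plaquette_anyDisplay` with its block-majorant letter `hD2` re-typed as print's sentence (3.137), `λ := λ₀·e^{σ r_D}·c₀(1,σ)^d`
substituted into `q, θ_P, θ_D, B_E^{G′}`; for every direction `μ`; conclusion verbatim: `G′`, `(Q_kG′Q_k†)⁻¹` two-sided and `∀ δ′, δ′∕8 ≤ ρ → Ineq190 S^{coarse}_m
S^{fine}_m ((D_U∘(·)_μ)∘(H₀ + G̃Δ⁽²⁾H₀)) (A₀ᴱ + B_Eᵗθ_Dc) δ′` at the consumer's display ∕ witness).  Mechanism: §1 `localSup_package` fed to «Y12h».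
[cite: Balaban1985BackgroundPropagators, (3.137)–(3.138) p.423, Thm 3.1 (3.42) p.397, Thm 3.3 p.399, Thm 3.11 p.416, (3.35)–(3.37) p.396, (3.126) p.420, (3.132)–(3.133) p.422]
[cite: Balaban1985Variational, (182) p.307, (190) p.308, (129)–(131) pp.297–298, (180) p.306] [cite: Balaban1985Averaging, Prop. 2 (52)–(54) p.26, (122) p.36]
[cite: Balaban1984PropagatorsII, (2.51)–(2.52) p.232, (2.54) p.233, Lemma 2.1 (2.61) p.234] -/
theorem exists_ineq190_sliceGrad_origin_tower_plaquette_localSup :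
    ∃ αs B δ BE A' r₁ : ℝ, 0 < αs ∧ 0 ≤ B ∧ 0 < δ ∧ 0 ≤ BE ∧ 0 ≤ A' ∧ 0 < r₁ ∧
      ∀ (n : ℕ) (η : ℝ) (_hηL : η * (L : ℝ) ^ (n + 1) = 1) (c₀ c₁ : ℝ) [Fact (0 < c₀)] [Fact (0 < c₁)]
        (_hw : c₀ * ((L : ℝ) ^ (n + 1)) ^ d = c₁) (_hρ : |η| ^ d / c₀ ≤ ρw) (m : Fin d → ℕ) [∀ i, NeZero (m i)] (_hm : ∀ i, 1 ≤ m i)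
        (U : Bond d (towerP L m (n + 1)) → 𝔸ˣ) (_hUu : ∀ b, U b ∈ unitaryUnits 𝔸)
        (α : ℝ) (_hα : 0 ≤ α) (_hαle : α ≤ αs) (_hUη : ∀ b, ‖(U b : 𝔸) - 1‖ ≤ α * η)
        (_hpl : ∀ p : B9SectCLatticeCarrier.Plaq d (towerP L m (n + 1)), ‖(plaqHolU U p : 𝔸) - 1‖ ≤ α * η ^ 2)
        (_hUgrad : ∀ (x : TSite d (towerP L m (n + 1))) (μ : Fin d), ‖(U (x, μ) : 𝔸) - U (unshift μ x, μ)‖ ≤ α * η ^ 2)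
        -- the consumer's OWN regularity display, onto-threshold and positivity witness (ANY admissible ones):
        (αU : ℕ → ℝ) (hα1 : ∀ j, αU j ≤ 1 / 64) (hαL : ∀ j, 50 * (d + 1) * αU j * (L : ℝ) ^ d ≤ 1 / 2)
        (hU1 : ∀ (j : ℕ) (x : B7Prop1Explicit.Site d) (k : Fin d), perCfg (towerP L m (j + 1)) (UlevOf L m (n + 1) U j) x k ∈ U1 𝔸)
        (hreg : ∀ (j : ℕ) (y : TSite d (towerP L m j)) (k : Fin d) (ρ' : Fin d → Fin L),
          ‖((Wcx L (perCfg (towerP L m (j + 1)) (UlevOf L m (n + 1) U j)) (cornerSite L y) k (boxVec L ρ') : 𝔸ˣ) : 𝔸) - 1‖ ≤ αU j)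
        (hpos : ∀ x : BondL2K ℂ d (towerP L m (n + 1)) c₀ W, x ≠ 0 →
          0 < RCLike.re ⟪x, laplaceAk L m n φ η U hL αU hα1 hU1 hreg τ (c₀ := c₀) (c₁ := c₁) a x⟫_ℂ)
        (η₀ L₀ M₀ R : ℝ) (H : Prop) (μ : Fin d)
        -- the rates and the (free) row-sum constant
        (ρ σ c : ℝ) (_hσ : 0 < σ) (_hρ0 : 0 ≤ ρ) (_hρ₁ : ρ + 5 * σ ≤ δ / d) (_hρI : ρ + 5 * σ ≤ r₁ / d) (_hc_def : c = B6.c0 1 σ ^ d)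
    -- `Δ⁽²⁾` IN PRINT's (3.137) DISPLAY: a `ℂ`-linear operator on the fine carrier whose value at a fine bond `b` is bounded by `λ₀ ×` the supremum
    -- of its argument over the fine bonds whose blocks lie within `ℓ¹`-distance `r_D` of the block of `b` («the supremum |A| is taken over several
    -- j-blocks surrounding Δ(y)»); NODE-O-class identification of Bałaban's `Δ⁽²⁾(U)` NOT done
    (D2 : BondL2K ℂ d (towerP L m (n + 1)) c₀ W →ₗ[ℂ] BondL2K ℂ d (towerP L m (n + 1)) c₀ W)
    {lam₀ rD : ℝ} (hlam₀ : 0 ≤ lam₀)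
    (hD2 : ∀ (A : Bond d (towerP L m (n + 1)) → W) (b : Bond d (towerP L m (n + 1))) (F : ℝ), 0 ≤ F →
      (∀ b' : Bond d (towerP L m (n + 1)),
        tdist1 m (UT.ofSite m (blockCoord (L ^ (n + 1)) m (siteCast (towerP_eq_fineP_pow L m (n + 1)) (bpos b))))
          (UT.ofSite m (blockCoord (L ^ (n + 1)) m (siteCast (towerP_eq_fineP_pow L m (n + 1)) (bpos b')))) ≤ rD → ‖A b'‖ ≤ F) →
      ‖((WL2.linearEquiv ℂ ℂ (fun _ : Bond d (towerP L m (n + 1)) => c₀) :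
            BondL2K ℂ d (towerP L m (n + 1)) c₀ W ≃ₗ[ℂ] (Bond d (towerP L m (n + 1)) → W)).toLinearMap ∘ₗ D2 ∘ₗ
          (WL2.linearEquiv ℂ ℂ (fun _ : Bond d (towerP L m (n + 1)) => c₀) :
            BondL2K ℂ d (towerP L m (n + 1)) c₀ W ≃ₗ[ℂ] (Bond d (towerP L m (n + 1)) → W)).symm.toLinearMap) A b‖ ≤ lam₀ * F)
    -- the derived constants, bound to their closed forms (instantiate with `rfl`; `λ = λ₀·e^{σ r_D}·c`), and the TWO smallnesses in `λ₀`
    {q BG' θP qI BI' A₀ θD A₀E BEG' BEt : ℝ}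
    (hq_def : q = B * (lam₀ * Real.exp (σ * rD) * c) * Real.exp (δ / d * rD) * c) (hq : q < 1) (hBG' : BG' = B * (1 - q)⁻¹)
    (hθP : θP = B * (lam₀ * Real.exp (σ * rD) * c) * Real.exp (δ / d * rD) * BG' * c *
      ((Mφ' * Real.exp (100 * d * (d + 1) * (L : ℝ) ^ d * AQ) * Mφ * ((2 * d : ℕ) : ℝ)) * Real.exp 1 * latticeConst d 1) *
      Real.exp ((ρ + 4 * σ) * d) * ((Mφ' * Mφ * Real.exp (50 * (d + 1) * AQ)) * Real.exp 1 * latticeConst d 1) *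
      Real.exp ((ρ + 4 * σ) * d))
    (hqI : qI = A' * θP * c * c) (hqI1 : qI < 1) (hBI' : BI' = A' * (1 - qI)⁻¹)
    (hA₀ : A₀ = B * ((Mφ' * Real.exp (100 * d * (d + 1) * (L : ℝ) ^ d * AQ) * Mφ * ((2 * d : ℕ) : ℝ)) * Real.exp 1 *
      latticeConst d 1) * Real.exp δ * A' * c)
    (hθD : θD = A₀ * (lam₀ * Real.exp (σ * rD) * c) * Real.exp (ρ * rD))
    (hA₀E : A₀E = BE * ((Mφ' * Real.exp (100 * d * (d + 1) * (L : ℝ) ^ d * AQ) * Mφ * ((2 * d : ℕ) : ℝ)) * Real.exp 1 * latticeConst d 1) * Real.exp δ * A' * c)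
    (hBEG' : BEG' = BE + BE * (lam₀ * Real.exp (σ * rD) * c) * Real.exp (δ / d * rD) * BG' * c)
    (hBEt : BEt = BEG' + ((Mφ' * Mφ * Real.exp (50 * (d + 1) * AQ)) * Real.exp 1 * latticeConst d 1) *
      ((Mφ' * Real.exp (100 * d * (d + 1) * (L : ℝ) ^ d * AQ) * Mφ * ((2 * d : ℕ) : ℝ)) * Real.exp 1 * latticeConst d 1) *
      BI' * BEG' * BG' * Real.exp ((ρ + 2 * σ) * d) * Real.exp ((ρ + 2 * σ) * d) * c * c),
    ∃ (G' : (Bond d (towerP L m (n + 1)) → W) →L[ℂ] (Bond d (towerP L m (n + 1)) → W))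
      (Inv' : (Bond d m → W) →L[ℂ] (Bond d m → W)),
      -- `G′ = (Δ_{a,k}(U) − Δ⁽²⁾)⁻¹`, two-sided
      G' * (LinearMap.toContinuousLinearMap
          ((WL2.linearEquiv ℂ ℂ (fun _ : Bond d (towerP L m (n + 1)) => c₀) :
              BondL2K ℂ d (towerP L m (n + 1)) c₀ W ≃ₗ[ℂ] (Bond d (towerP L m (n + 1)) → W)).toLinearMap ∘ₗ
            laplaceAk L m n φ η U hL αU hα1 hU1 hreg τ (c₀ := c₀) (c₁ := c₁) a ∘ₗ
            (WL2.linearEquiv ℂ ℂ (fun _ : Bond d (towerP L m (n + 1)) => c₀) :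
              BondL2K ℂ d (towerP L m (n + 1)) c₀ W ≃ₗ[ℂ] (Bond d (towerP L m (n + 1)) → W)).symm.toLinearMap) -
        LinearMap.toContinuousLinearMap
          ((WL2.linearEquiv ℂ ℂ (fun _ : Bond d (towerP L m (n + 1)) => c₀) :
              BondL2K ℂ d (towerP L m (n + 1)) c₀ W ≃ₗ[ℂ] (Bond d (towerP L m (n + 1)) → W)).toLinearMap ∘ₗ D2 ∘ₗ
            (WL2.linearEquiv ℂ ℂ (fun _ : Bond d (towerP L m (n + 1)) => c₀) :
              BondL2K ℂ d (towerP L m (n + 1)) c₀ W ≃ₗ[ℂ] (Bond d (towerP L m (n + 1)) → W)).symm.toLinearMap)) = 1 ∧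
      (LinearMap.toContinuousLinearMap
          ((WL2.linearEquiv ℂ ℂ (fun _ : Bond d (towerP L m (n + 1)) => c₀) :
              BondL2K ℂ d (towerP L m (n + 1)) c₀ W ≃ₗ[ℂ] (Bond d (towerP L m (n + 1)) → W)).toLinearMap ∘ₗ
            laplaceAk L m n φ η U hL αU hα1 hU1 hreg τ (c₀ := c₀) (c₁ := c₁) a ∘ₗ
            (WL2.linearEquiv ℂ ℂ (fun _ : Bond d (towerP L m (n + 1)) => c₀) :
              BondL2K ℂ d (towerP L m (n + 1)) c₀ W ≃ₗ[ℂ] (Bond d (towerP L m (n + 1)) → W)).symm.toLinearMap) -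
        LinearMap.toContinuousLinearMap
          ((WL2.linearEquiv ℂ ℂ (fun _ : Bond d (towerP L m (n + 1)) => c₀) :
              BondL2K ℂ d (towerP L m (n + 1)) c₀ W ≃ₗ[ℂ] (Bond d (towerP L m (n + 1)) → W)).toLinearMap ∘ₗ D2 ∘ₗ
            (WL2.linearEquiv ℂ ℂ (fun _ : Bond d (towerP L m (n + 1)) => c₀) :
              BondL2K ℂ d (towerP L m (n + 1)) c₀ W ≃ₗ[ℂ] (Bond d (towerP L m (n + 1)) → W)).symm.toLinearMap)) * G' = 1 ∧
      -- `Inv′ = (Q_kG′Q_k†)⁻¹`, two-sided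
      Inv' * ((LinearMap.toContinuousLinearMap
          ((WL2.linearEquiv ℂ ℂ (fun _ : Bond d m => c₁) : BondL2K ℂ d m c₁ W ≃ₗ[ℂ] (Bond d m → W)).toLinearMap ∘ₗ
            QkW L m n φ U hL αU hα1 hU1 hreg (c₀ := c₀) (c₁ := c₁) ∘ₗ
            (WL2.linearEquiv ℂ ℂ (fun _ : Bond d (towerP L m (n + 1)) => c₀) :
              BondL2K ℂ d (towerP L m (n + 1)) c₀ W ≃ₗ[ℂ] (Bond d (towerP L m (n + 1)) → W)).symm.toLinearMap)).comp
        (G'.comp (LinearMap.toContinuousLinearMap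
          ((WL2.linearEquiv ℂ ℂ (fun _ : Bond d (towerP L m (n + 1)) => c₀) :
              BondL2K ℂ d (towerP L m (n + 1)) c₀ W ≃ₗ[ℂ] (Bond d (towerP L m (n + 1)) → W)).toLinearMap ∘ₗ
            LinearMap.adjoint (QkW L m n φ U hL αU hα1 hU1 hreg (c₀ := c₀) (c₁ := c₁)) ∘ₗ
            (WL2.linearEquiv ℂ ℂ (fun _ : Bond d m => c₁) : BondL2K ℂ d m c₁ W ≃ₗ[ℂ] (Bond d m → W)).symm.toLinearMap)))) = 1 ∧
      ((LinearMap.toContinuousLinearMap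
          ((WL2.linearEquiv ℂ ℂ (fun _ : Bond d m => c₁) : BondL2K ℂ d m c₁ W ≃ₗ[ℂ] (Bond d m → W)).toLinearMap ∘ₗ
            QkW L m n φ U hL αU hα1 hU1 hreg (c₀ := c₀) (c₁ := c₁) ∘ₗ
            (WL2.linearEquiv ℂ ℂ (fun _ : Bond d (towerP L m (n + 1)) => c₀) :
              BondL2K ℂ d (towerP L m (n + 1)) c₀ W ≃ₗ[ℂ] (Bond d (towerP L m (n + 1)) → W)).symm.toLinearMap)).comp
        (G'.comp (LinearMap.toContinuousLinearMap
          ((WL2.linearEquiv ℂ ℂ (fun _ : Bond d (towerP L m (n + 1)) => c₀) :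
              BondL2K ℂ d (towerP L m (n + 1)) c₀ W ≃ₗ[ℂ] (Bond d (towerP L m (n + 1)) → W)).toLinearMap ∘ₗ
            LinearMap.adjoint (QkW L m n φ U hL αU hα1 hU1 hreg (c₀ := c₀) (c₁ := c₁)) ∘ₗ
            (WL2.linearEquiv ℂ ℂ (fun _ : Bond d m => c₁) : BondL2K ℂ d m c₁ W ≃ₗ[ℂ] (Bond d m → W)).symm.toLinearMap)))) * Inv' = 1 ∧
      -- the (190) letter of `H₀ + G̃Δ⁽²⁾H₀`, `H₀ = H₁,k(U)` by name, `G̃ = G′ − G′Q_k†·Inv′·Q_kG′`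
      ∀ δ' : ℝ, δ' / 8 ≤ ρ →
        Ineq190
          (supSize (toB6 (torusGeom m η₀ L₀ M₀) R H)
            (fun y => Finset.univ.filter fun c : Bond d m => bpos c = UT.toSite m y)
            (fun c => UT.ofSite m (bpos c)) : BlockNorm (toB6 (torusGeom m η₀ L₀ M₀) R H) (Bond d m → W))
          (supSize (toB6 (torusGeom m η₀ L₀ M₀) R H)
            (fun y => Finset.univ.filter fun b : Bond d (towerP L m (n + 1)) =>
              blockCoord (L ^ (n + 1)) m (siteCast (towerP_eq_fineP_pow L m (n + 1)) (btgt b)) = UT.toSite m y)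
            (fun b => UT.ofSite m (blockCoord (L ^ (n + 1)) m (siteCast (towerP_eq_fineP_pow L m (n + 1)) (btgt b)))) :
              BlockNorm (toB6 (torusGeom m η₀ L₀ M₀) R H) (Bond d (towerP L m (n + 1)) → W))
          ((((WL2.linearEquiv ℂ ℂ (fun _ : Bond d (towerP L m (n + 1)) => c₀) :
                BondL2K ℂ d (towerP L m (n + 1)) c₀ W ≃ₗ[ℂ] (Bond d (towerP L m (n + 1)) → W)).toLinearMap ∘ₗ
              covDerivL2K ℂ c₀ ((η : ℂ))⁻¹ (adTransportW φ U) ∘ₗ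
              (WL2.linearEquiv ℂ ℂ (fun _ : TSite d (towerP L m (n + 1)) => c₀) :
                SiteL2K ℂ d (towerP L m (n + 1)) c₀ W ≃ₗ[ℂ] (TSite d (towerP L m (n + 1)) → W)).symm.toLinearMap ∘ₗ
              (LinearMap.pi fun y : TSite d (towerP L m (n + 1)) =>
                (LinearMap.proj ((y, μ) : Bond d (towerP L m (n + 1))) : (Bond d (towerP L m (n + 1)) → W) →ₗ[ℂ] W))).restrictScalars ℝ) ∘ₗ
          ((((WL2.linearEquiv ℂ ℂ (fun _ : Bond d (towerP L m (n + 1)) => c₀) :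
                  BondL2K ℂ d (towerP L m (n + 1)) c₀ W ≃ₗ[ℂ] (Bond d (towerP L m (n + 1)) → W)).toLinearMap ∘ₗ
              H1k L m n φ η U hL αU hα1 hU1 hreg τ (c₀ := c₀) (c₁ := c₁) hαL hpos ∘ₗ
              (WL2.linearEquiv ℂ ℂ (fun _ : Bond d m => c₁) : BondL2K ℂ d m c₁ W ≃ₗ[ℂ] (Bond d m → W)).symm.toLinearMap).restrictScalars ℝ) +
            ((G'.restrictScalars ℝ : (Bond d (towerP L m (n + 1)) → W) →ₗ[ℝ] (Bond d (towerP L m (n + 1)) → W)) -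
              ((G'.restrictScalars ℝ : (Bond d (towerP L m (n + 1)) → W) →ₗ[ℝ] (Bond d (towerP L m (n + 1)) → W)) ∘ₗ
                (((WL2.linearEquiv ℂ ℂ (fun _ : Bond d (towerP L m (n + 1)) => c₀) :
                      BondL2K ℂ d (towerP L m (n + 1)) c₀ W ≃ₗ[ℂ] (Bond d (towerP L m (n + 1)) → W)).toLinearMap ∘ₗ
                  LinearMap.adjoint (QkW L m n φ U hL αU hα1 hU1 hreg (c₀ := c₀) (c₁ := c₁)) ∘ₗ
                  (WL2.linearEquiv ℂ ℂ (fun _ : Bond d m => c₁) : BondL2K ℂ d m c₁ W ≃ₗ[ℂ] (Bond d m → W)).symm.toLinearMap).restrictScalars ℝ)) ∘ₗ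
              (Inv'.restrictScalars ℝ : (Bond d m → W) →ₗ[ℝ] (Bond d m → W)) ∘ₗ
              ((((WL2.linearEquiv ℂ ℂ (fun _ : Bond d m => c₁) : BondL2K ℂ d m c₁ W ≃ₗ[ℂ] (Bond d m → W)).toLinearMap ∘ₗ
                  QkW L m n φ U hL αU hα1 hU1 hreg (c₀ := c₀) (c₁ := c₁) ∘ₗ
                  (WL2.linearEquiv ℂ ℂ (fun _ : Bond d (towerP L m (n + 1)) => c₀) :
                    BondL2K ℂ d (towerP L m (n + 1)) c₀ W ≃ₗ[ℂ] (Bond d (towerP L m (n + 1)) → W)).symm.toLinearMap).restrictScalars ℝ) ∘ₗ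
                (G'.restrictScalars ℝ : (Bond d (towerP L m (n + 1)) → W) →ₗ[ℝ] (Bond d (towerP L m (n + 1)) → W)))) ∘ₗ
            ((((WL2.linearEquiv ℂ ℂ (fun _ : Bond d (towerP L m (n + 1)) => c₀) :
                    BondL2K ℂ d (towerP L m (n + 1)) c₀ W ≃ₗ[ℂ] (Bond d (towerP L m (n + 1)) → W)).toLinearMap ∘ₗ D2 ∘ₗ
                (WL2.linearEquiv ℂ ℂ (fun _ : Bond d (towerP L m (n + 1)) => c₀) :
                  BondL2K ℂ d (towerP L m (n + 1)) c₀ W ≃ₗ[ℂ] (Bond d (towerP L m (n + 1)) → W)).symm.toLinearMap).restrictScalars ℝ) ∘ₗ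
              (((WL2.linearEquiv ℂ ℂ (fun _ : Bond d (towerP L m (n + 1)) => c₀) :
                    BondL2K ℂ d (towerP L m (n + 1)) c₀ W ≃ₗ[ℂ] (Bond d (towerP L m (n + 1)) → W)).toLinearMap ∘ₗ
                H1k L m n φ η U hL αU hα1 hU1 hreg τ (c₀ := c₀) (c₁ := c₁) hαL hpos ∘ₗ
                (WL2.linearEquiv ℂ ℂ (fun _ : Bond d m => c₁) : BondL2K ℂ d m c₁ W ≃ₗ[ℂ] (Bond d m → W)).symm.toLinearMap).restrictScalars ℝ))))
          (A₀E + BEt * θD * c) δ' := by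
  obtain ⟨αs, B, δ, BE, A', r₁, hαs, hB, hδ, hBE, hA', hr₁, HY⟩ :=
    exists_ineq190_sliceGrad_origin_tower_plaquette_anyDisplay hd L hL hL3 φ hMφ hMφ' hφ hφ' ha ha' τ hτ hCτ hτm hMτ hρw hτ₁ hτ₂ hφτ AQ hAQ16
  refine ⟨αs, B, δ, BE, A', r₁, hαs, hB, hδ, hBE, hA', hr₁, ?_⟩
  intro n η hηL c₀ c₁ _ _ hw hρ m _ hm U hUu α hα hαle hUη hpl hUgrad αU hα1 hαL hU1 hreg hpos η₀ L₀ M₀ R H μ ρ σ c hσ hρ0 hρ₁ hρI hc_def D2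
    lam₀ rD hlam₀ hD2 q BG' θP qI BI' A₀ θD A₀E BEG' BEt hq_def hq hBG' hθP hqI hqI1 hBI' hA₀ hθD hA₀E hBEG' hBEt
  obtain ⟨hlam, hKD, hDloc, hDrow, hDcol, hD2'⟩ :=
    localSup_package (L := L) (n := n) (c₀ := c₀) (W := W) m η₀ L₀ M₀ R H hσ hc_def D2 hlam₀ hD2
  exact HY n η hηL c₀ c₁ hw hρ m hm U hUu α hα hαle hUη hpl hUgrad αU hα1 hαL hU1 hreg hpos η₀ L₀ M₀ R H μ ρ σ c hσ hρ0 hρ₁ hρI hc_def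
    D2 hlam hKD hDloc hDrow hDcol hD2' hq_def hq hBG' hθP hqI hqI1 hBI' hA₀ hθD hA₀E hBEG' hBEt

end Tower

end Literature.MathematicalPhysics.QuantumFieldTheory.Balaban1983to89.Beta.RemainderOriginTowerSliceGradPlaquetteLocalSup

end
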